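import Summits.Schanuel.Schanuel.Theorems.ZilberEacDoubleCancellingExistence
import HarnessLib

/-!
# The double-cancelling regime: exponential points and their growth

Zilber's Exponential-Algebraic Closedness, case ladder (host summit Schanuel, cell `pub-schanuel`,
seat 2, gen 15; HANDOFF O59 PLAN).  From the core theorem `exists_doubleCancelling_core` we UNWIND
the exponential points of the explicit free family
`W = {x₂ = r₀x₀ + r₁x₁ + c, y₀ = x₀ + y₂F₀(y₂), y₁ = x₁ + y₂F₁(y₂)} ⊆ ℂ³ × ℂ³`
(`Fⱼ = Σ_{i<eⱼ} A_{j,i} Yⁱ`, `e₁ < e₀`, `r₀r₁ < 0`) in the DOUBLE-CANCELLING regime: both fibre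
coordinates sit at the cancelling fixed point, `xⱼ = −Wⱼ + ψ(e^{−Wⱼ})`, along one free label `n`.

* `eventually_const_add_log_le` — `C + log n ≤ εT(n)` eventually when `T → ∞`, `log n/T → 0`.
* **`exists_solutions_doubleCancelling`** — a sequence `x : ℕ → Fin 2 → ℂ` of solutions of both
  fibre equations `e^{xⱼ} = xⱼ + y₂Fⱼ(y₂)` (`y₂ = e^{r₀x₀ + r₁x₁ + c}`), with the TWO-SCALE growth
  data consumed by `unprojectedDense_of_twoScale`: `T := −Re x₁ → ∞`,
  `|Re x₀ − (r₁/r₀)T| ≤ εT`, `Re(r₀x₀ + r₁x₁ + c) → +∞` but `≤ εT`.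

HONEST FRAMING: explicit members of an OPEN cell (`ECCell 3 2`); NOT Schanuel's conjecture;
EAC ⇏ SC.
-/

noncomputable section

open Complex Filter Topology

set_option linter.dupNamespace false

namespace Summit.Schanuel.Schanuel.Theorems

section Solutions

/-- **Logarithms are slow**: if `T → ∞` and `log n / T(n) → 0` then `C + log n ≤ εT(n)`
eventually, for every constant `C` and every `ε > 0`. [folklore] -/
theorem eventually_const_add_log_le {T : ℕ → ℝ} (hT : Tendsto T atTop atTop)
    (hlog : Tendsto (fun n : ℕ => Real.log n / T n) atTop (𝓝 0)) (C : ℝ) {ε : ℝ} (hε : 0 < ε) :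
    ∀ᶠ n : ℕ in atTop, C + Real.log n ≤ ε * T n := by
  have h1 : Tendsto (fun n : ℕ => C / T n) atTop (𝓝 0) := by
    have h := hT.inv_tendsto_atTop.const_mul C
    rw [mul_zero] at h
    exact h.congr' (Eventually.of_forall fun n => by simp [div_eq_mul_inv])
  have h2 : Tendsto (fun n : ℕ => (C + Real.log n) / T n) atTop (𝓝 0) := by
    have h := h1.add hlog
    rw [add_zero] at h
    exact h.congr' (Eventually.of_forall fun n => (add_div _ _ _).symm)
  filter_upwards [h2.eventually (gt_mem_nhds hε), hT.eventually_gt_atTop 0] with n hn hTn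
  exact ((div_lt_iff₀ hTn).1 hn).le

/-- **THEOREM (exponential points in the double-cancelling regime).**  See the module docstring.
(new) [cite: MantovaMasser2023, §1 p.5 (the open case dim π(V) = 2 in ℂ³×ℂˣ³)] -/
theorem exists_solutions_doubleCancelling (e₀ e₁ : ℕ) (he₁ : 1 ≤ e₁) (he : e₁ < e₀)
    (A : Fin 2 → ℕ → ℂ) (ha₀ : A 0 (e₀ - 1) ≠ 0) (ha₁ : A 1 (e₁ - 1) ≠ 0)
    (r₀ r₁ : ℝ) (hr₀ : r₀ ≠ 0) (hsign : r₀ * r₁ < 0) (c : ℂ) {s : ℝ} (hs : s = 1 ∨ s = -1)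
    (j₀ : ℕ) {κ : ℝ} (hκ : 0 < κ)
    (hphase : κ * ‖A 1 (e₁ - 1)‖ ≤ (A 1 (e₁ - 1) * exp ((e₁ : ℂ) *
      (((Complex.arg (2 * Real.pi * I / ((r₀ : ℂ) * (A 0 (e₀ - 1) * s))) : ℝ) : ℂ) * I +
        2 * Real.pi * I * (j₀ : ℂ)) / (e₀ : ℂ))).re) :
    ∃ x : ℕ → Fin 2 → ℂ,
      Tendsto (fun n => -(x n 1).re) atTop atTop ∧
      (∀ ε : ℝ, 0 < ε → ∀ᶠ n in atTop,
        |(x n 0).re - r₁ / r₀ * (-(x n 1).re)| ≤ ε * (-(x n 1).re)) ∧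
      Tendsto (fun n => (∑ i, ((![r₀, r₁] : Fin 2 → ℝ) i : ℂ) * x n i + c).re) atTop atTop ∧
      (∀ ε : ℝ, 0 < ε → ∀ᶠ n in atTop,
        (∑ i, ((![r₀, r₁] : Fin 2 → ℝ) i : ℂ) * x n i + c).re ≤ ε * (-(x n 1).re)) ∧
      ∀ᶠ n in atTop,
        exp (x n 0) = x n 0 + exp (∑ i, ((![r₀, r₁] : Fin 2 → ℝ) i : ℂ) * x n i + c) *
            ∑ i ∈ Finset.range e₀, A 0 i *
              (exp (∑ i, ((![r₀, r₁] : Fin 2 → ℝ) i : ℂ) * x n i + c)) ^ i ∧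
        exp (x n 1) = x n 1 + exp (∑ i, ((![r₀, r₁] : Fin 2 → ℝ) i : ℂ) * x n i + c) *
            ∑ i ∈ Finset.range e₁, A 1 i *
              (exp (∑ i, ((![r₀, r₁] : Fin 2 → ℝ) i : ℂ) * x n i + c)) ^ i := by
  have he₀ : 1 ≤ e₀ := by omega
  have heR : (0 : ℝ) < e₀ := by exact_mod_cast (show 0 < e₀ by omega)
  have he1R : (1 : ℝ) ≤ e₀ := by exact_mod_cast he₀
  have hsC : (s : ℂ) ≠ 0 := by rcases hs with h | h <;> simp [h]
  have hAs : A 0 (e₀ - 1) * (s : ℂ) ≠ 0 := mul_ne_zero ha₀ hsC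
  obtain ⟨ψ, η, M, v, hη, hψ, hψsol, hv, hM, hlogM, hev⟩ :=
    exists_doubleCancelling_core e₀ e₁ he₁ he A ha₀ ha₁ r₀ r₁ hr₀ hsign c hs j₀ hκ hphase
  -- the data along the label `n`
  set τ : ℕ → ℂ := fun n =>
    Complex.log (2 * Real.pi * I * (n : ℂ) / ((r₀ : ℂ) * (A 0 (e₀ - 1) * s))) with hτ
  set P : ℕ → ℂ := fun n => exp (τ n / (e₀ : ℂ)) * exp (2 * Real.pi * I / (e₀ : ℂ)) ^ j₀ with hP
  set W : Fin 2 → ℕ → ℕ → ℂ := fun j e n => ∑ i ∈ Finset.range e, A j i * P n ^ (i + 1) *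
    exp ((((i : ℕ) : ℂ) + 1) * v n / (e₀ : ℂ)) with hW
  set x₂ : ℕ → ℂ := fun n => -(2 * Real.pi * I * (s : ℂ) * (n : ℂ)) +
    (τ n + 2 * Real.pi * I * j₀ + v n) / (e₀ : ℂ) with hx₂
  set x : ℕ → Fin 2 → ℂ := fun n =>
    ![-W 0 e₀ n + ψ (exp (-W 0 e₀ n)), -W 1 e₁ n + ψ (exp (-W 1 e₁ n))] with hx
  have hx0 : ∀ n, x n 0 = -W 0 e₀ n + ψ (exp (-W 0 e₀ n)) := fun n => rfl
  have hx1 : ∀ n, x n 1 = -W 1 e₁ n + ψ (exp (-W 1 e₁ n)) := fun n => rfl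
  have hev' : ∀ᶠ n : ℕ in atTop, Real.exp (-M n) < η ∧ M n ≤ (W 0 e₀ n).re ∧
      M n ≤ (W 1 e₁ n).re ∧ x₂ n = (r₀ : ℂ) * x n 0 + (r₁ : ℂ) * x n 1 + c :=
    hev.mono fun n hn => hn
  -- the plane coordinate
  have hℓ : ∀ n, ∑ i, ((![r₀, r₁] : Fin 2 → ℝ) i : ℂ) * x n i + c =
      (r₀ : ℂ) * x n 0 + (r₁ : ℂ) * x n 1 + c := by
    intro n
    simp only [Fin.sum_univ_two, Matrix.cons_val_zero, Matrix.cons_val_one]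
  -- `e^{(i+1)x₂} = P^{i+1} e^{(i+1)v/e₀}` and the fibre sums
  have hpow : ∀ n i : ℕ, exp (x₂ n) ^ (i + 1) =
      P n ^ (i + 1) * exp ((((i : ℕ) : ℂ) + 1) * v n / (e₀ : ℂ)) := by
    intro n i
    rw [← exp_succ_mul_x₂_eq hs n e₀ he₀ (τ n) (v n) j₀ i, ← Complex.exp_nat_mul, hx₂]
    push_cast
    ring_nf
  have hWexp : ∀ (j : Fin 2) (e n : ℕ),
      exp (x₂ n) * ∑ i ∈ Finset.range e, A j i * exp (x₂ n) ^ i = W j e n := by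
    intro j e n
    rw [hW]
    simp only
    rw [Finset.mul_sum]
    refine Finset.sum_congr rfl fun i _ => ?_
    rw [mul_assoc (A j i), ← hpow n i, pow_succ]
    ring
  -- sizes of the cancelling parameters
  have hεW : ∀ (j : Fin 2) (e n : ℕ), M n ≤ (W j e n).re → Real.exp (-M n) < η →
      ‖exp (-W j e n)‖ < η ∧ ‖exp (-W j e n)‖ ≤ Real.exp (-M n) := by
    intro j e n hM hη'
    have h : ‖exp (-W j e n)‖ ≤ Real.exp (-M n) := by
      rw [Complex.norm_exp, Complex.neg_re]
      exact Real.exp_le_exp.2 (by linarith)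
    exact ⟨h.trans_lt hη', h⟩
  -- THE FIBRE EQUATIONS
  have hsol : ∀ᶠ n in atTop,
      exp (x n 0) = x n 0 + exp (∑ i, ((![r₀, r₁] : Fin 2 → ℝ) i : ℂ) * x n i + c) *
          ∑ i ∈ Finset.range e₀, A 0 i *
            (exp (∑ i, ((![r₀, r₁] : Fin 2 → ℝ) i : ℂ) * x n i + c)) ^ i ∧
      exp (x n 1) = x n 1 + exp (∑ i, ((![r₀, r₁] : Fin 2 → ℝ) i : ℂ) * x n i + c) *
          ∑ i ∈ Finset.range e₁, A 1 i *
            (exp (∑ i, ((![r₀, r₁] : Fin 2 → ℝ) i : ℂ) * x n i + c)) ^ i := by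
    filter_upwards [hev'] with n hn
    obtain ⟨hη', hM0, hM1, hplane⟩ := hn
    rw [hℓ n, ← hplane, hWexp 0 e₀ n, hWexp 1 e₁ n, hx0 n, hx1 n]
    exact ⟨hψsol _ (hεW 0 e₀ n hM0 hη').1 (W 0 e₀ n) rfl,
      hψsol _ (hεW 1 e₁ n hM1 hη').1 (W 1 e₁ n) rfl⟩
  -- GROWTH (a): `T := −Re x₁ ≥ M − 2 → ∞`, `log n / T → 0`
  have hM0 : ∀ᶠ n : ℕ in atTop, 0 ≤ M n := hM.eventually_ge_atTop 0
  have hT_ge : ∀ᶠ n : ℕ in atTop, M n - 2 ≤ -(x n 1).re := by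
    filter_upwards [hev', hM0] with n hn hMn
    obtain ⟨hη', -, hM1, -⟩ := hn
    obtain ⟨hlt, hle⟩ := hεW 1 e₁ n hM1 hη'
    have h1 : |(ψ (exp (-W 1 e₁ n))).re| ≤ 2 := by
      refine (Complex.abs_re_le_norm _).trans (((hψ _ hlt).2).trans ?_)
      have : Real.exp (-M n) ≤ 1 := by rw [Real.exp_le_one_iff]; linarith
      linarith
    rw [hx1 n, Complex.add_re, Complex.neg_re]
    have := (abs_le.1 h1).2
    linarith
  have hT : Tendsto (fun n => -(x n 1).re) atTop atTop :=
    tendsto_atTop_mono' atTop hT_ge (tendsto_atTop_add_const_right _ _ hM)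
  have hlogT : Tendsto (fun n : ℕ => Real.log n / (-(x n 1).re)) atTop (𝓝 0) := by
    have h2 := hlogM.const_mul 2
    rw [mul_zero] at h2
    refine squeeze_zero' ?_ ?_ h2
    · filter_upwards [hT.eventually_ge_atTop 0] with n hn
      exact div_nonneg (Real.log_natCast_nonneg n) hn
    · filter_upwards [hT_ge, hM.eventually_ge_atTop 4] with n hn hM4
      have hlog0 : 0 ≤ Real.log n := Real.log_natCast_nonneg n
      have hMpos : 0 < M n := by linarith
      calc Real.log n / (-(x n 1).re) ≤ Real.log n / (M n / 2) :=
            div_le_div_of_nonneg_left hlog0 (by linarith) (by linarith)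
        _ = 2 * (Real.log n / M n) := by field_simp
  -- GROWTH (b): the real part of the plane coordinate is logarithmic
  set Cq : ℝ := 2 * Real.pi / (|r₀| * ‖A 0 (e₀ - 1) * (s : ℂ)‖) with hCq
  have hCqpos : 0 < Cq := div_pos (by positivity) (mul_pos (abs_pos.2 hr₀) (norm_pos_iff.2 hAs))
  have hreτ : ∀ n : ℕ, 1 ≤ n → (τ n).re = Real.log Cq + Real.log n := by
    intro n hn
    have hnpos : (0 : ℝ) < n := by exact_mod_cast hn
    rw [hτ]
    simp only
    rw [show ((n : ℂ)) = (((n : ℝ)) : ℂ) by norm_cast, re_log_label_quot hnpos hr₀ hAs]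
  have hrex₂ : ∀ n : ℕ, (x₂ n).re = ((τ n).re + (v n).re) / e₀ := by
    intro n
    rw [hx₂]
    simp only
    rw [Complex.add_re, Complex.neg_re, Complex.div_natCast_re, Complex.add_re, Complex.add_re,
      show (2 * Real.pi * I * (s : ℂ) * (n : ℂ)) = 2 * Real.pi * I * (((s * n : ℝ)) : ℂ) by
        push_cast; ring,
      show (2 * Real.pi * I * (j₀ : ℂ)) = 2 * Real.pi * I * (((j₀ : ℝ)) : ℂ) by norm_cast,
      re_two_pi_I_mul_ofReal, re_two_pi_I_mul_ofReal]
    ring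
  have hv1 : ∀ᶠ n : ℕ in atTop, ‖v n‖ ≤ 1 :=
    (tendsto_zero_iff_norm_tendsto_zero.1 hv).eventually (ge_mem_nhds one_pos)
  -- the bound `|Re x₂| ≤ |log Cq| + 1 + log n` (uses `e₀ ≥ 1`, `‖v‖ ≤ 1`)
  have hx₂bd : ∀ᶠ n : ℕ in atTop, |(x₂ n).re| ≤ |Real.log Cq| + 1 + Real.log n := by
    filter_upwards [hv1, eventually_ge_atTop 1] with n hvn hn
    have hlog0 : 0 ≤ Real.log n := Real.log_natCast_nonneg n
    have hvre : |(v n).re| ≤ 1 := (Complex.abs_re_le_norm _).trans hvn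
    rw [hrex₂ n, hreτ n hn, abs_div, abs_of_pos heR]
    calc |Real.log Cq + Real.log n + (v n).re| / e₀
        ≤ |Real.log Cq + Real.log n + (v n).re| / 1 :=
          div_le_div_of_nonneg_left (abs_nonneg _) one_pos he1R
      _ ≤ |Real.log Cq| + 1 + Real.log n := by
          rw [div_one]
          have h1 := abs_add_le (Real.log Cq + Real.log n) (v n).re
          have h2 := abs_add_le (Real.log Cq) (Real.log n)
          rw [abs_of_nonneg hlog0] at h2
          linarith
  refine ⟨x, hT, fun ε hε => ?_, ?_, fun ε hε => ?_, hsol⟩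
  · -- `|Re x₀ − (r₁/r₀)T| = |Re x₂ − Re c|/|r₀| ≤ εT`
    have hr₀pos : 0 < |r₀| := abs_pos.2 hr₀
    filter_upwards [hev', hx₂bd, eventually_const_add_log_le hT hlogT (|Real.log Cq| + 1 + ‖c‖)
      (mul_pos hε hr₀pos)] with n hn hbd hlog
    obtain ⟨-, -, -, hplane⟩ := hn
    have hre : (x₂ n).re = r₀ * (x n 0).re + r₁ * (x n 1).re + c.re := by
      have := congrArg Complex.re hplane
      simpa only [Complex.add_re, Complex.re_ofReal_mul] using this
    have hid : (x n 0).re - r₁ / r₀ * (-(x n 1).re) = ((x₂ n).re - c.re) / r₀ := by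
      field_simp
      linarith
    rw [hid, abs_div]
    have hc : |c.re| ≤ ‖c‖ := Complex.abs_re_le_norm c
    have hnum : |(x₂ n).re - c.re| ≤ ε * |r₀| * (-(x n 1).re) := by
      calc |(x₂ n).re - c.re| ≤ |(x₂ n).re| + |c.re| := abs_sub _ _
        _ ≤ |Real.log Cq| + 1 + ‖c‖ + Real.log n := by linarith
        _ ≤ ε * |r₀| * (-(x n 1).re) := hlog
    calc |(x₂ n).re - c.re| / |r₀| ≤ ε * |r₀| * (-(x n 1).re) / |r₀| :=
          div_le_div_of_nonneg_right hnum hr₀pos.le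
      _ = ε * (-(x n 1).re) := by field_simp
  · -- `Re ℓ = Re x₂ → +∞`
    have hlim : Tendsto (fun n : ℕ => (Real.log Cq + Real.log n + -1) / e₀) atTop atTop := by
      refine Tendsto.atTop_div_const heR (tendsto_atTop_add_const_right _ _
        (tendsto_atTop_add_const_left _ _ ?_))
      exact Real.tendsto_log_atTop.comp tendsto_natCast_atTop_atTop
    refine tendsto_atTop_mono' atTop ?_ hlim
    filter_upwards [hev', hv1, eventually_ge_atTop 1] with n hn hvn hn1
    obtain ⟨-, -, -, hplane⟩ := hn
    have hvre : -1 ≤ (v n).re := (abs_le.1 ((Complex.abs_re_le_norm _).trans hvn)).1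
    rw [hℓ n, ← hplane, hrex₂ n, hreτ n hn1]
    exact div_le_div_of_nonneg_right (by linarith) heR.le
  · -- `Re ℓ ≤ εT`
    filter_upwards [hev', hx₂bd, eventually_const_add_log_le hT hlogT (|Real.log Cq| + 1) hε]
      with n hn hbd hlog
    obtain ⟨-, -, -, hplane⟩ := hn
    rw [hℓ n, ← hplane]
    exact ((le_abs_self _).trans hbd).trans hlog

end Solutions

end Summit.Schanuel.Schanuel.Theorems
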